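import Summits.ValiantsHypothesis.ValiantsHypothesis.Theorems.KPlusLogSqLawSymmetricTwoKChain
import Summits.ValiantsHypothesis.ValiantsHypothesis.Theorems.KPlusLogSqLawSymmetricDesignGraft

/-!
# Route «KPlusLogSqLaw» — the `(2,K)` symmetric chain BORDERED: `ζ₊sym(m,K) ≥ (m+1)·K − m − 2` for every `m ≥ 2`, `K ≥ 3`

HONEST FRAMING.  Helper file (seat typer (g11), cell `pub-symmetroid`, 2026-08-27; desk R1641 / R1651 (β) «RailRay follow-ons»;
`--supports` the `WeakLifting` item stmt-ValiantsHypothesis-19561 as a helper, no closure claim).  No definitions.  LOWER census floors: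
lift-p2 g3's SYMMETRIC `(2,K)` design family with `3K − 4` alternations for every `K ≥ 3` (`TropicalCensus.SymTwoK.chainT` / `thC` /
`isDominant_chainT` / `alternates_chainT` on the design `dd`, `vv`, `ee`; real row `SymTwoK.not_posRootLawAt_two`: `ζ₊sym(2,K) ≥ 3K − 4`)
fed to the SYMMETRIC DESIGNS GRAFT in its BILINEAR form (`TropicalCensus.not_posRootLawAt_bilinear_of_symmDesign`: a symmetric design with
`B` alternations and `K` letters, bordered `i` times (`+(K − 1)` zeros each) and grafted `j` times (`+(2 + i)` zeros each)):
**`¬ PosRootLawAt (2 + i) (K + j) (3K − 5 + i·(K − 1) + j·(2 + i))` for all `K ≥ 3`, `i`, `j`** (`not_posRootLawAt_twoK_quadrant`), and in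
particular (`j = 0`, `m = 2 + i`) **`ζ₊sym(m,K) ≥ (m + 1)·K − m − 2` for every `m ≥ 2`, `K ≥ 3`** (`not_posRootLawAt_chain_border`):
an all-format FLOOR FAMILY of slope `m + 1` per letter.  Against the tree: the all-format floor of record `Census.Graft.not_posRootLawAt_graft`
(`ζ₊sym(m,K) ≥ m² + (K − 2)·m`, slope `m`) is exceeded exactly when `K > m² − m + 2`; the cell's census / rail / ray rows are stronger at
small `K` (e.g. `m = 3`: rail `6K − 9` for `K ≤ 10`, ray `3K + 21`; this family wins from `K = 27` on: `(3,27) ≥ 103`; `m = 4`: from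
`K = 27` over `4K + 20`; `m = 6`: from `K = 33` over `6K + 24`).  Nothing here bears on DoorA26 / DoorA34 (`PosRootLawAt 2 6 19` /
`PosRootLawAt 3 4 18`, OPEN, typed, never asserted), on `TropicalB` / `WeakLifting`, on `MatrixDescartes` (stmt-ValiantsHypothesis-18050) or on
`VP ≠ VNP`; a lower census bound refutes no law of record.  [folklore]
-/

-- `Summit.ValiantsHypothesis.ValiantsHypothesis.…` repeats a component by the D-0017 layout
-- (single-conjunct summit), which the `dupNamespace` linter flags; the name is mandated.
set_option linter.dupNamespace false
set_option autoImplicit false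

namespace Summit.ValiantsHypothesis.ValiantsHypothesis.Theorems.LacunarySymmetroidMatrixDescartes.TropicalCensus.SymTwoK

open Summit.ValiantsHypothesis.ValiantsHypothesis.Theorems.MatrixDescartes.Negative
open Summit.ValiantsHypothesis.ValiantsHypothesis.Theorems.LacunarySymmetroidMatrixDescartes
open Summit.ValiantsHypothesis.ValiantsHypothesis.Theorems.LacunarySymmetroidMatrixDescartes.TropicalCensus
open scoped BigOperators

/-- **The `(2,K)` chain quadrant**: for `K ≥ 3` and all `i, j`, `¬ PosRootLawAt (2 + i) (K + j) (3K − 5 + i·(K − 1) + j·(2 + i))` —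
the symmetric `(2,K)` design with `3K − 4` alternations bordered `i` times and grafted `j` times:
`ζ₊sym(2 + i, K + j) ≥ 3K − 4 + i(K − 1) + j(2 + i)`. [folklore] -/
theorem not_posRootLawAt_twoK_quadrant (K : ℕ) (hK : 3 ≤ K) (i j : ℕ) :
    ¬ PosRootLawAt (2 + i) (K + j) (3 * K - 5 + i * (K - 1) + j * (2 + i)) := by
  obtain ⟨K', rfl⟩ : ∃ K', K = K' + 1 := ⟨K - 1, by omega⟩
  have h := not_posRootLawAt_bilinear_of_symmDesign (m := 2) (K := K') (B := 3 * (K' + 1) - 4) (by omega)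
    (dd (K' + 1)) (vv (K' + 1)) (ee (K' + 1)) (vv_symm (K' + 1)) (ee_symm (K' + 1)) (ee_natAbs (K' + 1))
    (fun k => thC (K' + 1) k)
    (Fin.strictMono_iff_lt_succ.mpr fun k => by
      simpa only [Fin.val_castSucc, Fin.val_succ] using thC_lt_succ (K' + 1) hK k)
    (fun k => chainT (K' + 1) hK k)
    (fun k => isDominant_chainT (K' + 1) hK k (by have := k.isLt; omega))
    (fun k => by
      simpa only [Fin.val_castSucc, Fin.val_succ] using alternates_chainT (K' + 1) hK k (by have := k.isLt; omega))
    i j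
  have e : 3 * (K' + 1) - 4 + i * K' + j * (2 + i) - 1 = 3 * (K' + 1) - 5 + i * (K' + 1 - 1) + j * (2 + i) := by
    rw [Nat.add_sub_cancel]; omega
  rw [e] at h
  exact h

/-- **CHAIN BORDER — an all-format floor family of slope `m + 1`**: for every `m ≥ 2` and `K ≥ 3`,
`¬ PosRootLawAt m K ((m + 1)·(K − 1) − 2)`, i.e. `ζ₊sym(m,K) ≥ (m + 1)·K − m − 2` (the `(2,K)` chain bordered `m − 2` times).  Exceeds the
tree's all-format floor `m² + (K − 2)·m` (`Census.Graft.not_posRootLawAt_graft`) exactly when `K > m² − m + 2`. [folklore] -/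
theorem not_posRootLawAt_chain_border (m K : ℕ) (hm : 2 ≤ m) (hK : 3 ≤ K) :
    ¬ PosRootLawAt m K ((m + 1) * (K - 1) - 2) := by
  obtain ⟨i, rfl⟩ := Nat.exists_eq_add_of_le hm
  obtain ⟨X, rfl⟩ : ∃ X, K = X + 1 := ⟨K - 1, by omega⟩
  have h := not_posRootLawAt_twoK_quadrant (X + 1) hK i 0
  have e1 : X + 1 + 0 = X + 1 := by omega
  have e2 : 3 * (X + 1) - 5 + i * (X + 1 - 1) + 0 * (2 + i) = (2 + i + 1) * (X + 1 - 1) - 2 := by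
    rw [Nat.add_sub_cancel]
    have : (2 + i + 1) * X = 3 * X + i * X := by ring
    rw [this]
    omega
  rw [e1, e2] at h
  exact h

/-! ### Numeral rows where the family first wins (census format `(m,K) ≥ B + 1` reads `¬ PosRootLawAt m K B`) -/

/-- `ζ₊sym(3,27) ≥ 103` (rail ray: `102`). [folklore] -/
theorem chain_border_3_27 : ¬ PosRootLawAt 3 27 102 := by
  have h := not_posRootLawAt_chain_border 3 27 (by norm_num) (by norm_num)
  norm_num at h
  exact h

/-- `ζ₊sym(4,27) ≥ 129` (rail quadrant: `128`). [folklore] -/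
theorem chain_border_4_27 : ¬ PosRootLawAt 4 27 128 := by
  have h := not_posRootLawAt_chain_border 4 27 (by norm_num) (by norm_num)
  norm_num at h
  exact h

/-- `ζ₊sym(6,33) ≥ 223` (all-format floor: `222`). [folklore] -/
theorem chain_border_6_33 : ¬ PosRootLawAt 6 33 222 := by
  have h := not_posRootLawAt_chain_border 6 33 (by norm_num) (by norm_num)
  norm_num at h
  exact h

end Summit.ValiantsHypothesis.ValiantsHypothesis.Theorems.LacunarySymmetroidMatrixDescartes.TropicalCensus.SymTwoK
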